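/-
Copyright (c) 2026. All rights reserved.
Released under Apache 2.0 license as described in the file LICENSE.
Authors: abc-iut cell, prover seat abc-iut-w5-d241 (wave 5, gen 9).
-/
import Summits.ABC.IUTFork.Cor312PilotIdelesPrArchThetaSide
import Summits.ABC.IUTFork.Cor312ArchCornerSign
import Summits.ABC.IUTFork.Cor312PilotIdelesPrWitness
import Literature.IUT.LogVolume.PilotDivisorsArchThreshold
import HarnessLib

/-!
# The fourth corner: Team B's region-volume input is a HEIGHT BOUND on the Tate divisor

Proof-only corollary (one theorem family, no definitions) of abc-iut-c312-7's
`Cor312PilotIdelesPrArchThetaSide.lean` (`globalVolumeTransport_settingPrVolArchSharp_iff`: at the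
print-normalised setting with pilot regions from realising ideles and abc-iut-w5-d163's honest
archimedean container, `GlobalVolumeTransport ↔ −deĝ̲(P_q) ≤ −deĝ̲_lgp(P_Θ) + 𝔼_j |S^±_{j+1}|·log π`)
composed with the two independent kernel evaluations of that right-hand side landed minutes apart:
`Literature/IUT/LogVolume/PilotDivisorsArchThreshold.lean` (abc-iut-w5-d241, p435152: for any constant
`c`, the inequality holds iff `deĝ̲(𝔮) ≤ 6·l·(l+5)·c/((l+4)(l−3))`, envelope `6·c ≤ · ≤ (50/3)·c`) and
`Cor312ArchCornerSign.lean` (abc-iut-w5-d235, p435436: `archCornerIneq_iff_ndeg_qDivisor_le`,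
`card_caps_labelSucc`, and the reading at genuine data `archCornerIneq_iff_logq`).

* **`globalVolumeTransport_settingPrVolArchSharp_iff_ndeg_qDivisor_le`** — at the fourth corner,
  `GlobalVolumeTransport ↔ deĝ̲(𝔮) ≤ (6·l·(l+5)/((l+4)(l−3)))·log π`;
* `not_globalVolumeTransport_settingPrVolArchSharp_of_lt` — it FAILS whenever `deĝ̲(𝔮) > (50/3)·log π`
  (`< 19.1`; every `l ≥ 5`); `globalVolumeTransport_settingPrVolArchSharp_of_le` — it HOLDS whenever
  `deĝ̲(𝔮) ≤ 6·log π`;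
* `globalVolumeTransport_settingPrVolArchSharp_iff_logq` — at GENUINE data (`Cor312Prov.IsPilotDataOf D X`,
  abc-iut-c312-8): `GlobalVolumeTransport ↔ (l+4)(l−3)·log(q) ≤ 6·l·(l+5)·log π`.

So the region-volume input G-c312-11-1 of plan/GAP-LEDGER.md, which is REFUTED at the trivial-`∞` corner
(`not_globalVolumeTransport_settingPrVolSharp`, c312-7) and was recorded at the honest-`∞` corner as
"one explicit real inequality in `(F, E, l)`, sign not evaluated" (plan/C312-RESIDUALS.md §0), holds there
EXACTLY on pilot data of bounded normalised Tate-divisor degree `deĝ̲(𝔮) = (1/[F:ℚ])·Σ_{v∈S} ord_v(q_v)·log N(v)`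
— a height-type bound uniform in `F` and `l` — and fails off that family.  HONEST FRAMING: the
`∞`-boxes are abc-iut-w5-d163's MODEL; this evaluates a number at one instantiation of the typed
setting; it asserts nothing about [IUTchIII] Cor. 3.12 and takes no side.  typed ≠ proved;
instantiated ≠ endorsed.
-/

noncomputable section

open Set Function NumberField IsDedekindDomain
open scoped Pointwise

universe v w

namespace Summit.ABC

namespace IUTFork

namespace Thm311

namespace Real

open Cor312 Cor312Vol Literature.IUT.LogThetaLattice Literature.IUT.LogVolume

section Caps

variable {F : Type} [Field F] [NumberField F] (X : PilotData F)

/-- The honest-`∞` container's procession-normalised archimedean constant, rewritten in the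
`PilotDivisorsArchThreshold` form `𝔼_i (i+2)·log π` over `Fin X.lstar` (`(thetaIndex X).lstar = X.lstar`,
`|S^±_{i+2}| = i+2` = abc-iut-w5-d235's `card_caps_labelSucc`).
[cite: Mochizuki2012, IUTchIII Prop. 3.9 (i) p. 116] -/
private theorem processionNormalized_card_caps_eq_cast :
    processionNormalized (fun i : Fin (thetaIndex X).lstar =>
        (Fintype.card ((thetaIndex X).Caps (Setting.labelSucc i)) : ℝ) * Real.log Real.pi) =
      processionNormalized (fun i : Fin X.lstar => (((i : ℕ) + 2 : ℕ) : ℝ) * Real.log Real.pi) := by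
  show processionNormalized (fun i : Fin X.lstar =>
        (Fintype.card ((thetaIndex X).Caps (Setting.labelSucc i)) : ℝ) * Real.log Real.pi) = _
  congr 1
  funext i
  rw [card_caps_labelSucc X i]

end Caps

variable {F : Type} [Field F] [NumberField F] (X : PilotData F) {logv : PadicLogs F} (hlog : LogvAnalytic logv)
  (hc : ∀ w : InfinitePlace F, w.IsComplex) (M : Type) [Field M] [NumberField M]
  (archPk : ∀ (j : (thetaIndex X).Label) (vQ : (thetaIndex X).VQ), Set ((logShellsDH X logv).Packet j vQ))
  (archSub : ∀ (j : (thetaIndex X).Label) (v : (thetaIndex X).V),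
    Set ((logShellsDH X logv).Packet j ((thetaIndex X).over v)))
  (Ψ : ℤ → ∀ v : (thetaIndex X).V, v ∈ (thetaIndex X).Vbad → Set ((logShellsDH X logv).StarPacket v))
  (act : ℤ → ∀ v : (thetaIndex X).V, v ∈ (thetaIndex X).Vbad →
    (logShellsDH X logv).StarPacket v → Module.End ℚ ((logShellsDH X logv).StarPacket v))
  (Mmod : ℤ → ∀ j : (thetaIndex X).LabelStar, Set ((logShellsDH X logv).GlobalPacket j.1))
  (region : ℤ → ∀ j : (thetaIndex X).LabelStar, FinDivisor M → ∀ vQ : (thetaIndex X).VQ,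
    Set ((logShellsDH X logv).Packet j.1 vQ))
  (n : ℤ) {HT : Type} {LogLink : HT → HT → Type} {IsFull : ∀ {s t : HT}, LogLink s t → Prop}
  (lat : LGPGaussianLogThetaLattice LogLink IsFull)
  {Frd : Type} {IsoF : Frd → Frd → Type} {Ob : Frd → Type} {realify : Frd → Frd} {Strip : Type}
  {IsoS : Strip → Strip → Type} {Mv : ∀ v : (thetaIndex X).V, v ∈ (thetaIndex X).Vbad → Type}
  [∀ v h, Monoid (Mv v h)]
  (sig : GlobalLGPFrobenioidSignature (thetaIndex X).lstar (thetaIndex X).V (· ∈ (thetaIndex X).Vbad)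
    Frd IsoF Ob realify Strip IsoS Mv)
  (split : SplittingMonoids Mv) {ObΔ : Type} {N : ∀ v : (thetaIndex X).V, v ∈ (thetaIndex X).Vbad → Type}
  [∀ v h, Monoid (N v h)] (qData : QPilotData ObΔ N)
  (t : ∀ (pp : Nat.Primes) (_ : Fin X.lstar) (x : (thetaIndex X).Fibre (.inr pp)),
    haveI : Fact (pp : ℕ).Prime := ⟨pp.2⟩; kOf X pp.1 x)
  (tq : ∀ (pp : Nat.Primes) (x : (thetaIndex X).Fibre (.inr pp)), haveI : Fact (pp : ℕ).Prime := ⟨pp.2⟩; kOf X pp.1 x)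
  (ht0 : ∀ pp i x, t pp i x ≠ 0)
  (ht : ∀ (pp : Nat.Primes) (i : Fin X.lstar) (x : (thetaIndex X).Fibre (.inr pp)),
    haveI : Fact (pp : ℕ).Prime := ⟨pp.2⟩
    Real.log ‖t pp i x‖ = -(X.thetaPilot i (placeOf X pp.1 x)) * logNorm F (placeOf X pp.1 x) /
      localDegree F (placeOf X pp.1 x))
  (htq0 : ∀ pp x, tq pp x ≠ 0)
  (htq1 : ∀ (pp : Nat.Primes) (x : (thetaIndex X).Fibre (.inr pp)),
    haveI : Fact (pp : ℕ).Prime := ⟨pp.2⟩; placeOf X pp.1 x ∉ X.S → ‖tq pp x‖ = 1)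

include ht0 ht in
/-- **The fourth corner's region-volume input is a bound on the Tate divisor.** At the print-normalised
setting with pilot regions from realising ideles and the honest archimedean container,
`GlobalVolumeTransport ↔ deĝ̲(𝔮) ≤ 6·l·(l+5)·log π/((l+4)(l−3))`, `𝔮 = Σ_{v∈S} ord_v(q_v)[v]`.
[claim: Mochizuki2012, status: disputed] for the quoted setting;
[cite: Mochizuki2012, IUTchIV Thm 1.10 proof Step (vii) p. 30] [cite: DupuyHilado2025, §3.3, Thm. 3.10.1] -/
theorem globalVolumeTransport_settingPrVolArchSharp_iff_ndeg_qDivisor_le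
    (htq : ∀ (pp : Nat.Primes) (x : (thetaIndex X).Fibre (.inr pp)),
      haveI : Fact (pp : ℕ).Prime := ⟨pp.2⟩
      Real.log ‖tq pp x‖ = -(X.qPilot (placeOf X pp.1 x)) * logNorm F (placeOf X pp.1 x) /
        localDegree F (placeOf X pp.1 x)) :
    GlobalVolumeTransport (settingPrVolArchSharp X hlog hc M archPk archSub Ψ act Mmod region n lat sig split qData t tq htq0 htq1) ↔
      FinDivisor.ndeg F X.qDivisor ≤ 6 * X.l * (X.l + 5) / ((X.l + 4) * (X.l - 3)) * Real.log Real.pi := by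
  rw [globalVolumeTransport_settingPrVolArchSharp_iff X hlog hc M archPk archSub Ψ act Mmod region n lat sig split qData
      t tq ht0 ht htq0 htq1 htq]
  exact archCornerIneq_iff_ndeg_qDivisor_le X

include ht0 ht in
/-- **Failure above the envelope:** if `deĝ̲(𝔮) > (50/3)·log π` (`≈ 19.08`), the fourth corner's
`GlobalVolumeTransport` is FALSE — for every admissible `l ≥ 5`. [claim: Mochizuki2012, status: disputed]
for the quoted setting; [cite: DupuyHilado2025, §3.3, Thm. 3.10.1] -/
theorem not_globalVolumeTransport_settingPrVolArchSharp_of_lt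
    (htq : ∀ (pp : Nat.Primes) (x : (thetaIndex X).Fibre (.inr pp)),
      haveI : Fact (pp : ℕ).Prime := ⟨pp.2⟩
      Real.log ‖tq pp x‖ = -(X.qPilot (placeOf X pp.1 x)) * logNorm F (placeOf X pp.1 x) /
        localDegree F (placeOf X pp.1 x))
    (hbig : 50 / 3 * Real.log Real.pi < FinDivisor.ndeg F X.qDivisor) :
    ¬ GlobalVolumeTransport
      (settingPrVolArchSharp X hlog hc M archPk archSub Ψ act Mmod region n lat sig split qData t tq htq0 htq1) := by
  rw [globalVolumeTransport_settingPrVolArchSharp_iff X hlog hc M archPk archSub Ψ act Mmod region n lat sig split qData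
      t tq ht0 ht htq0 htq1 htq, processionNormalized_card_caps_eq_cast X]
  exact X.not_neg_ndeg_qPilot_le_log_pi_of_lt hbig

include ht0 ht in
/-- **Validity below the envelope:** if `deĝ̲(𝔮) ≤ 6·log π` (`≈ 6.87`), the fourth corner's
`GlobalVolumeTransport` HOLDS — for every admissible `l ≥ 5`. [claim: Mochizuki2012, status: disputed]
for the quoted setting; [cite: DupuyHilado2025, §3.3, Thm. 3.10.1] -/
theorem globalVolumeTransport_settingPrVolArchSharp_of_le
    (htq : ∀ (pp : Nat.Primes) (x : (thetaIndex X).Fibre (.inr pp)),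
      haveI : Fact (pp : ℕ).Prime := ⟨pp.2⟩
      Real.log ‖tq pp x‖ = -(X.qPilot (placeOf X pp.1 x)) * logNorm F (placeOf X pp.1 x) /
        localDegree F (placeOf X pp.1 x))
    (hsmall : FinDivisor.ndeg F X.qDivisor ≤ 6 * Real.log Real.pi) :
    GlobalVolumeTransport
      (settingPrVolArchSharp X hlog hc M archPk archSub Ψ act Mmod region n lat sig split qData t tq htq0 htq1) := by
  rw [globalVolumeTransport_settingPrVolArchSharp_iff X hlog hc M archPk archSub Ψ act Mmod region n lat sig split qData
      t tq ht0 ht htq0 htq1 htq, processionNormalized_card_caps_eq_cast X]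
  exact X.neg_ndeg_qPilot_le_log_pi_of_le hsmall

include ht0 ht in
/-- **At GENUINE data** (`Cor312Prov.IsPilotDataOf D X`, abc-iut-c312-8: the pilot data `X` is that of
the initial Θ-datum `D`, so `deĝ̲(𝔮) = log(q)` via abc-iut-w5-d235's `archCornerIneq_iff_logq`):
`GlobalVolumeTransport ↔ (l+4)(l−3)·log(q) ≤ 6·l·(l+5)·log π`. [claim: Mochizuki2012, status: disputed]
for the quoted setting; [cite: DupuyHilado2025, §3.3, Thm. 3.10.1] -/
theorem globalVolumeTransport_settingPrVolArchSharp_iff_logq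
    {K : Type v} {Fbar : Type w} [Field K] [NumberField K] [Algebra F K] [Field Fbar] [Algebra F Fbar]
    [Algebra K Fbar] {E : WeierstrassCurve F} [E.IsElliptic] {l : ℕ}
    {Pb : Literature.IUT.HodgeTheaters.BadPlacePredicates K}
    {D : Literature.IUT.HodgeTheaters.InitialThetaData F K Fbar E l Pb} (hD : Cor312Prov.IsPilotDataOf D X)
    (htq : ∀ (pp : Nat.Primes) (x : (thetaIndex X).Fibre (.inr pp)),
      haveI : Fact (pp : ℕ).Prime := ⟨pp.2⟩
      Real.log ‖tq pp x‖ = -(X.qPilot (placeOf X pp.1 x)) * logNorm F (placeOf X pp.1 x) /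
        localDegree F (placeOf X pp.1 x)) :
    GlobalVolumeTransport (settingPrVolArchSharp X hlog hc M archPk archSub Ψ act Mmod region n lat sig split qData t tq htq0 htq1) ↔
      ((l : ℝ) + 4) * (l - 3) * Cor312Prov.logq D ≤ 6 * l * (l + 5) * Real.log Real.pi := by
  rw [globalVolumeTransport_settingPrVolArchSharp_iff X hlog hc M archPk archSub Ψ act Mmod region n lat sig split qData
      t tq ht0 ht htq0 htq1 htq]
  exact Cor312Prov.archCornerIneq_iff_logq hD


/-! ## Appendix (v2). The small-height regime: the typed `Statement` HOLDS at the fourth corner -/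

include ht0 ht in
/-- **Small Tate height ⇒ the typed Cor. 3.12 `Statement` holds at the fourth corner.** If
`deĝ̲(𝔮) ≤ 6·log π` then `GlobalVolumeTransport` holds (`globalVolumeTransport_settingPrVolArchSharp_of_le`),
hence — by abc-iut-c312-7's `statement_settingPrVolArchSharp_of_globalVolumeTransport` (hull ⊇ images, monotone
volumes) — so does `Statement` at `settingPrVolArchSharp`: the honest-`∞` container's `(j+1)·log π` terms alone
pay for the degree gap `deĝ̲_lgp(P_Θ) − deĝ̲(P_q) = ((l+4)(l−3)/(24l))·deĝ̲(𝔮)` when `𝔮` is small.  A census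
datum about abc-iut-w5-d163's archimedean MODEL container (it makes the typed inequality cheap at small
height), not about the printed Cor. 3.12. [claim: Mochizuki2012, status: disputed] for the quoted setting;
[cite: DupuyHilado2025, §3.3, Thm. 3.10.1] -/
theorem statement_settingPrVolArchSharp_of_ndeg_qDivisor_le
    (ht1 : ∀ (pp : Nat.Primes) (i : Fin X.lstar) (x : (thetaIndex X).Fibre (.inr pp)),
      haveI : Fact (pp : ℕ).Prime := ⟨pp.2⟩; placeOf X pp.1 x ∉ X.S → ‖t pp i x‖ = 1)
    (htq : ∀ (pp : Nat.Primes) (x : (thetaIndex X).Fibre (.inr pp)),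
      haveI : Fact (pp : ℕ).Prime := ⟨pp.2⟩
      Real.log ‖tq pp x‖ = -(X.qPilot (placeOf X pp.1 x)) * logNorm F (placeOf X pp.1 x) /
        localDegree F (placeOf X pp.1 x))
    (hsmall : FinDivisor.ndeg F X.qDivisor ≤ 6 * Real.log Real.pi) :
    (settingPrVolArchSharp X hlog hc M archPk archSub Ψ act Mmod region n lat sig split qData t tq htq0 htq1).Statement :=
  statement_settingPrVolArchSharp_of_globalVolumeTransport X hlog hc M archPk archSub Ψ act Mmod region n lat sig split
    qData t tq ht0 ht1 htq0 htq1
    (globalVolumeTransport_settingPrVolArchSharp_of_le X hlog hc M archPk archSub Ψ act Mmod region n lat sig split qData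
      t tq ht0 ht htq0 htq1 htq hsmall)

include ht0 ht in
/-- **At GENUINE data with `log(q) ≤ 6·log π` (`≈ 6.87`) the typed `Statement` holds at the fourth corner**
(`Cor312Prov.IsPilotDataOf D X`; `deĝ̲(𝔮) = log(q)` by abc-iut-c312-8's `logq_eq_ndeg_qDivisor`).
[claim: Mochizuki2012, status: disputed] for the quoted setting; [cite: DupuyHilado2025, §3.3, Thm. 3.10.1] -/
theorem statement_settingPrVolArchSharp_of_logq_le
    {K : Type v} {Fbar : Type w} [Field K] [NumberField K] [Algebra F K] [Field Fbar] [Algebra F Fbar]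
    [Algebra K Fbar] {E : WeierstrassCurve F} [E.IsElliptic] {l : ℕ}
    {Pb : Literature.IUT.HodgeTheaters.BadPlacePredicates K}
    {D : Literature.IUT.HodgeTheaters.InitialThetaData F K Fbar E l Pb} (hD : Cor312Prov.IsPilotDataOf D X)
    (ht1 : ∀ (pp : Nat.Primes) (i : Fin X.lstar) (x : (thetaIndex X).Fibre (.inr pp)),
      haveI : Fact (pp : ℕ).Prime := ⟨pp.2⟩; placeOf X pp.1 x ∉ X.S → ‖t pp i x‖ = 1)
    (htq : ∀ (pp : Nat.Primes) (x : (thetaIndex X).Fibre (.inr pp)),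
      haveI : Fact (pp : ℕ).Prime := ⟨pp.2⟩
      Real.log ‖tq pp x‖ = -(X.qPilot (placeOf X pp.1 x)) * logNorm F (placeOf X pp.1 x) /
        localDegree F (placeOf X pp.1 x))
    (hq : Cor312Prov.logq D ≤ 6 * Real.log Real.pi) :
    (settingPrVolArchSharp X hlog hc M archPk archSub Ψ act Mmod region n lat sig split qData t tq htq0 htq1).Statement :=
  statement_settingPrVolArchSharp_of_ndeg_qDivisor_le X hlog hc M archPk archSub Ψ act Mmod region n lat sig split qData
    t tq ht0 ht htq0 htq1 ht1 htq (by rwa [← Cor312Prov.logq_eq_ndeg_qDivisor hD])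

include ht0 ht in
/-- **Large Tate height ⇒ Team B's route is CLOSED at the fourth corner** (the typed `Statement` is then
exactly the hull question): if `deĝ̲(𝔮) > (50/3)·log π` then `¬ GlobalVolumeTransport`, while
`Statement ↔ ↑(−deĝ̲(P_q)) ≤ −|log Θ|` (abc-iut-c312-7's `statement_settingPrVolArchSharp_iff`) is untouched —
recorded as the conjunction. [claim: Mochizuki2012, status: disputed] for the quoted setting;
[cite: DupuyHilado2025, §3.3, Thm. 3.10.1] -/
theorem not_globalVolumeTransport_and_statement_iff_of_lt
    (ht1 : ∀ (pp : Nat.Primes) (i : Fin X.lstar) (x : (thetaIndex X).Fibre (.inr pp)),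
      haveI : Fact (pp : ℕ).Prime := ⟨pp.2⟩; placeOf X pp.1 x ∉ X.S → ‖t pp i x‖ = 1)
    (htq : ∀ (pp : Nat.Primes) (x : (thetaIndex X).Fibre (.inr pp)),
      haveI : Fact (pp : ℕ).Prime := ⟨pp.2⟩
      Real.log ‖tq pp x‖ = -(X.qPilot (placeOf X pp.1 x)) * logNorm F (placeOf X pp.1 x) /
        localDegree F (placeOf X pp.1 x))
    (hbig : 50 / 3 * Real.log Real.pi < FinDivisor.ndeg F X.qDivisor) :
    ¬ GlobalVolumeTransport
        (settingPrVolArchSharp X hlog hc M archPk archSub Ψ act Mmod region n lat sig split qData t tq htq0 htq1) ∧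
      ((settingPrVolArchSharp X hlog hc M archPk archSub Ψ act Mmod region n lat sig split qData t tq htq0 htq1).Statement ↔
        (((-FinDivisor.ndeg F X.qPilot : ℝ) : WithTop ℝ) ≤
          (settingPrVolArchSharp X hlog hc M archPk archSub Ψ act Mmod region n lat sig split qData t tq htq0 htq1).negLogTheta)) :=
  ⟨not_globalVolumeTransport_settingPrVolArchSharp_of_lt X hlog hc M archPk archSub Ψ act Mmod region n lat sig split qData
      t tq ht0 ht htq0 htq1 htq hbig,
    statement_settingPrVolArchSharp_iff X hlog hc M archPk archSub Ψ act Mmod region n lat sig split qData t tq htq0 htq1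
      htq ht0 ht1⟩


/-! ## Appendix (v3). The sharp small-height form and the EXISTENCE forms: for small-height pilot data with
`2l ∣ ord_v(q_v)` on `S`, realising ideles EXIST at which the typed `Statement` HOLDS at the fourth corner —
the positive mirror, at this corner, of the (G3) re-gluing countermodels (`IsSettingOf ∧ BridgeHyps ∧ AbsLogQPos ∧ ¬Statement`,
abc-iut-c312-7 `settingPrVolSharp_isSettingOf_not_imp_statement` at the trivial-`∞` corner) -/

include ht0 ht in
/-- **Sharp small-height form:** `deĝ̲(𝔮) ≤ c(l)·log π`, `c(l) = 6l(l+5)/((l+4)(l−3))`, ⇒ the typed `Statement`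
holds at the fourth corner. [claim: Mochizuki2012, status: disputed] for the quoted setting;
[cite: DupuyHilado2025, §3.3, Thm. 3.10.1] -/
theorem statement_settingPrVolArchSharp_of_ndeg_qDivisor_le_archConst
    (ht1 : ∀ (pp : Nat.Primes) (i : Fin X.lstar) (x : (thetaIndex X).Fibre (.inr pp)),
      haveI : Fact (pp : ℕ).Prime := ⟨pp.2⟩; placeOf X pp.1 x ∉ X.S → ‖t pp i x‖ = 1)
    (htq : ∀ (pp : Nat.Primes) (x : (thetaIndex X).Fibre (.inr pp)),
      haveI : Fact (pp : ℕ).Prime := ⟨pp.2⟩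
      Real.log ‖tq pp x‖ = -(X.qPilot (placeOf X pp.1 x)) * logNorm F (placeOf X pp.1 x) /
        localDegree F (placeOf X pp.1 x))
    (h : FinDivisor.ndeg F X.qDivisor ≤ 6 * X.l * (X.l + 5) / ((X.l + 4) * (X.l - 3)) * Real.log Real.pi) :
    (settingPrVolArchSharp X hlog hc M archPk archSub Ψ act Mmod region n lat sig split qData t tq htq0 htq1).Statement :=
  statement_settingPrVolArchSharp_of_globalVolumeTransport X hlog hc M archPk archSub Ψ act Mmod region n lat sig split
    qData t tq ht0 ht1 htq0 htq1
    ((globalVolumeTransport_settingPrVolArchSharp_iff_ndeg_qDivisor_le X hlog hc M archPk archSub Ψ act Mmod region n lat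
      sig split qData t tq ht0 ht htq0 htq1 htq).mpr h)

/-- **EXISTENCE FORM (pilot-data level).** For pilot data with `2l ∣ ord_v(q_v)` on `S` ([IUTchI] Ex. 3.2 (iv); realising
ideles then exist, abc-iut-c312-3 `exists_realising_thetaIdeles` / `exists_realising_qIdeles`) and SMALL height
`deĝ̲(𝔮) ≤ c(l)·log π`, there are realising Θ- and `q`-ideles at which, at the fourth corner, SIMULTANEOUSLY:
`ThetaFinite ∧ BridgeHyps ∧ AbsLogQPos ∧ GlobalVolumeTransport ∧ Statement` — for every choice of the free context
binders. A positive instance family of the typed Cor. 3.12 `Statement` at an honest-`∞`, print-normalised setting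
(census datum on the `∞`-MODEL container; no judgement on print). [claim: Mochizuki2012, status: disputed] for the
quoted setting; [cite: DupuyHilado2025, §3.3, §3.4, Thm. 3.10.1]; [cite: Mochizuki2012, IUTchI Ex. 3.2 (iv)] -/
theorem exists_ideles_statement_settingPrVolArchSharp (hdiv : ∀ v ∈ X.S, (2 * X.l : ℤ) ∣ X.ordq v)
    (h : FinDivisor.ndeg F X.qDivisor ≤ 6 * X.l * (X.l + 5) / ((X.l + 4) * (X.l - 3)) * Real.log Real.pi) :
    ∃ (t' : ∀ (pp : Nat.Primes) (_ : Fin X.lstar) (x : (thetaIndex X).Fibre (.inr pp)),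
          haveI : Fact (pp : ℕ).Prime := ⟨pp.2⟩; kOf X pp.1 x)
      (tq' : ∀ (pp : Nat.Primes) (x : (thetaIndex X).Fibre (.inr pp)), haveI : Fact (pp : ℕ).Prime := ⟨pp.2⟩; kOf X pp.1 x)
      (_ : ∀ pp i x, t' pp i x ≠ 0)
      (_ : ∀ (pp : Nat.Primes) (i : Fin X.lstar) (x : (thetaIndex X).Fibre (.inr pp)),
          haveI : Fact (pp : ℕ).Prime := ⟨pp.2⟩
          Real.log ‖t' pp i x‖ = -(X.thetaPilot i (placeOf X pp.1 x)) * logNorm F (placeOf X pp.1 x) /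
            localDegree F (placeOf X pp.1 x))
      (htq0' : ∀ pp x, tq' pp x ≠ 0)
      (htq1' : ∀ (pp : Nat.Primes) (x : (thetaIndex X).Fibre (.inr pp)),
          haveI : Fact (pp : ℕ).Prime := ⟨pp.2⟩; placeOf X pp.1 x ∉ X.S → ‖tq' pp x‖ = 1)
      (_ : ∀ (pp : Nat.Primes) (x : (thetaIndex X).Fibre (.inr pp)),
          haveI : Fact (pp : ℕ).Prime := ⟨pp.2⟩
          Real.log ‖tq' pp x‖ = -(X.qPilot (placeOf X pp.1 x)) * logNorm F (placeOf X pp.1 x) /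
            localDegree F (placeOf X pp.1 x)),
      (settingPrVolArchSharp X hlog hc M archPk archSub Ψ act Mmod region n lat sig split qData t' tq' htq0' htq1').ThetaFinite ∧
      BridgeHyps (settingPrVolArchSharp X hlog hc M archPk archSub Ψ act Mmod region n lat sig split qData t' tq' htq0' htq1') ∧
      (settingPrVolArchSharp X hlog hc M archPk archSub Ψ act Mmod region n lat sig split qData t' tq' htq0' htq1').AbsLogQPos ∧
      GlobalVolumeTransport
        (settingPrVolArchSharp X hlog hc M archPk archSub Ψ act Mmod region n lat sig split qData t' tq' htq0' htq1') ∧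
      (settingPrVolArchSharp X hlog hc M archPk archSub Ψ act Mmod region n lat sig split qData t' tq' htq0' htq1').Statement := by
  obtain ⟨t', ht0', ht'⟩ := exists_realising_thetaIdeles X hdiv
  obtain ⟨tq', htq0', htq'⟩ := exists_realising_qIdeles X hdiv
  have ht1' : ∀ (pp : Nat.Primes) (i : Fin X.lstar) (x : (thetaIndex X).Fibre (.inr pp)),
      haveI : Fact (pp : ℕ).Prime := ⟨pp.2⟩; placeOf X pp.1 x ∉ X.S → ‖t' pp i x‖ = 1 :=
    fun pp i x hx => norm_eq_one_of_realises X t' ht0' ht' pp i x hx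
  have htq1' : ∀ (pp : Nat.Primes) (x : (thetaIndex X).Fibre (.inr pp)),
      haveI : Fact (pp : ℕ).Prime := ⟨pp.2⟩; placeOf X pp.1 x ∉ X.S → ‖tq' pp x‖ = 1 :=
    fun pp x hx => qIdele_norm_eq_one_of_realises X tq' htq0' htq' pp x hx
  have hgvt : GlobalVolumeTransport
      (settingPrVolArchSharp X hlog hc M archPk archSub Ψ act Mmod region n lat sig split qData t' tq' htq0' htq1') :=
    (globalVolumeTransport_settingPrVolArchSharp_iff_ndeg_qDivisor_le X hlog hc M archPk archSub Ψ act Mmod region n lat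
      sig split qData t' tq' ht0' ht' htq0' htq1' htq').mpr h
  exact ⟨t', tq', ht0', ht', htq0', htq1', htq',
    thetaFinite_settingPrVolArchSharp X hlog hc M archPk archSub Ψ act Mmod region n lat sig split qData t' tq' ht0' ht1' htq0' htq1',
    bridgeHyps_settingPrVolArchSharp_of_ideles X hlog hc M archPk archSub Ψ act Mmod region n lat sig split qData t' tq' ht0' ht1'
      htq0' htq1',
    absLogQPos_settingPrVolArchSharp X hlog hc M archPk archSub Ψ act Mmod region n lat sig split qData t' tq' htq0' htq1' htq',
    hgvt,
    statement_settingPrVolArchSharp_of_globalVolumeTransport X hlog hc M archPk archSub Ψ act Mmod region n lat sig split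
      qData t' tq' ht0' ht1' htq0' htq1' hgvt⟩

/-- **EXISTENCE FORM WITH PROVENANCE (genuine data).** For every collection of initial Θ-data `D` whose pilot datum is
`X` (`IsPilotDataOf D X`), with the index bijection `hplaces`, `2l ∣ ord_v(q_v)` on `S`, and SMALL height
`(l+4)(l−3)·log(q) ≤ 6l(l+5)·log π`, there are realising ideles at which the fourth-corner setting `P` satisfies
**`IsSettingOf D P ∧ BridgeHyps P ∧ P.AbsLogQPos ∧ P.Statement`** — the exact positive mirror of the (G3) corner
`∃ P', IsSettingOf D P' ∧ BridgeHyps P' ∧ P'.AbsLogQPos ∧ ¬ P'.Statement` (abc-iut-c312-7, p427487, at the trivial-`∞`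
corner under its own packet hypotheses): together, for `D` meeting both hypothesis sets, the typed `Statement` is not
determined by {provenance, side conditions, `|log q| > 0`} over the typed interfaces — it depends on the container/glue.
[claim: Mochizuki2012, status: disputed] for the quoted setting; [cite: DupuyHilado2025, §3.3, §3.4, Thm. 3.10.1];
[cite: Mochizuki2012, IUTchI Ex. 3.2 (iv)] -/
theorem exists_ideles_isSettingOf_statement_settingPrVolArchSharp
    {K Fbar : Type} [Field K] [NumberField K] [Algebra F K] [Field Fbar] [Algebra F Fbar] [Algebra K Fbar]
    {E : WeierstrassCurve F} [E.IsElliptic] {l : ℕ} {Pb : Literature.IUT.HodgeTheaters.BadPlacePredicates K}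
    {D : Literature.IUT.HodgeTheaters.InitialThetaData F K Fbar E l Pb} (hX : Cor312Prov.IsPilotDataOf D X)
    (hplaces : ∃ e : (thetaIndex X).V ≃ D.V, ∀ v : (thetaIndex X).V,
      v ∈ (thetaIndex X).Vbad ↔ ((e v : D.V) : Literature.IUT.HodgeTheaters.Val K) ∈ D.Vbad)
    (hdiv : ∀ v ∈ X.S, (2 * X.l : ℤ) ∣ X.ordq v)
    (hq : ((l : ℝ) + 4) * (l - 3) * Cor312Prov.logq D ≤ 6 * l * (l + 5) * Real.log Real.pi) :
    ∃ (t' : ∀ (pp : Nat.Primes) (_ : Fin X.lstar) (x : (thetaIndex X).Fibre (.inr pp)),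
          haveI : Fact (pp : ℕ).Prime := ⟨pp.2⟩; kOf X pp.1 x)
      (tq' : ∀ (pp : Nat.Primes) (x : (thetaIndex X).Fibre (.inr pp)), haveI : Fact (pp : ℕ).Prime := ⟨pp.2⟩; kOf X pp.1 x)
      (htq0' : ∀ pp x, tq' pp x ≠ 0)
      (htq1' : ∀ (pp : Nat.Primes) (x : (thetaIndex X).Fibre (.inr pp)),
          haveI : Fact (pp : ℕ).Prime := ⟨pp.2⟩; placeOf X pp.1 x ∉ X.S → ‖tq' pp x‖ = 1),
      Cor312Prov.IsSettingOf D
          (settingPrVolArchSharp X hlog hc M archPk archSub Ψ act Mmod region n lat sig split qData t' tq' htq0' htq1') ∧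
      BridgeHyps (settingPrVolArchSharp X hlog hc M archPk archSub Ψ act Mmod region n lat sig split qData t' tq' htq0' htq1') ∧
      (settingPrVolArchSharp X hlog hc M archPk archSub Ψ act Mmod region n lat sig split qData t' tq' htq0' htq1').AbsLogQPos ∧
      (settingPrVolArchSharp X hlog hc M archPk archSub Ψ act Mmod region n lat sig split qData t' tq' htq0' htq1').Statement := by
  obtain ⟨t', ht0', ht'⟩ := exists_realising_thetaIdeles X hdiv
  obtain ⟨tq', htq0', htq'⟩ := exists_realising_qIdeles X hdiv
  have ht1' : ∀ (pp : Nat.Primes) (i : Fin X.lstar) (x : (thetaIndex X).Fibre (.inr pp)),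
      haveI : Fact (pp : ℕ).Prime := ⟨pp.2⟩; placeOf X pp.1 x ∉ X.S → ‖t' pp i x‖ = 1 :=
    fun pp i x hx => norm_eq_one_of_realises X t' ht0' ht' pp i x hx
  have htq1' : ∀ (pp : Nat.Primes) (x : (thetaIndex X).Fibre (.inr pp)),
      haveI : Fact (pp : ℕ).Prime := ⟨pp.2⟩; placeOf X pp.1 x ∉ X.S → ‖tq' pp x‖ = 1 :=
    fun pp x hx => qIdele_norm_eq_one_of_realises X tq' htq0' htq' pp x hx
  have hgvt : GlobalVolumeTransport
      (settingPrVolArchSharp X hlog hc M archPk archSub Ψ act Mmod region n lat sig split qData t' tq' htq0' htq1') :=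
    (globalVolumeTransport_settingPrVolArchSharp_iff_logq X hlog hc M archPk archSub Ψ act Mmod region n lat sig split qData
      t' tq' ht0' ht' htq0' htq1' hX htq').mpr hq
  exact ⟨t', tq', htq0', htq1',
    isSettingOf_settingPrVolArchSharp X hlog hc M archPk archSub Ψ act Mmod region n lat sig split qData t' tq' htq0' htq1' htq'
      hX hplaces,
    bridgeHyps_settingPrVolArchSharp_of_ideles X hlog hc M archPk archSub Ψ act Mmod region n lat sig split qData t' tq' ht0' ht1'
      htq0' htq1',
    absLogQPos_settingPrVolArchSharp X hlog hc M archPk archSub Ψ act Mmod region n lat sig split qData t' tq' htq0' htq1' htq',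
    statement_settingPrVolArchSharp_of_globalVolumeTransport X hlog hc M archPk archSub Ψ act Mmod region n lat sig split
      qData t' tq' ht0' ht1' htq0' htq1' hgvt⟩

end Real

end Thm311

end IUTFork

end Summit.ABC

end
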